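import Literature.NumberTheory.LFunctions.ZetaOneLineBounds
import Literature.NumberTheory.LFunctions.RieszMeanPerron
import Mathlib.Analysis.MellinInversion
import Mathlib.Analysis.SpecialFunctions.JapaneseBracket
import Mathlib.Analysis.SpecialFunctions.Pow.Asymptotics
import Mathlib.MeasureTheory.Integral.IntegralEqImproper
import Mathlib.NumberTheory.Chebyshev
import HarnessLib

/-!
# The prime number theorem with error `O_A(x (log x)^{-A})` (smoothed Perron + Titchmarsh §§3.6–3.7)

Topic `Literature/NumberTheory/LFunctions` (trunk T-ANT). Everything in this file is PROVED (no
named facts, no `sorry`). Main result: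

* `Literature.PsiLogPower.chebyshevPsi_sub_self_isBigO_div_logPow (A : ℝ)` —
  `ψ(x) - x = O(x/(log x)^A)` (`ψ` = Mathlib's `Chebyshev.psi`), for every real `A`.

This is the (weak, log-power) form of de la Vallée Poussin's prime number theorem that the tree's
`Literature.NumberTheory.Sieve.primesHaveLevel_iff_primesHaveLevelPi_of_isBigO`
(`Literature/NumberTheory/Sieve/LevelOfDistributionProofs.lean`) consumes; the printed theorem with
error `O(x exp(-c√log x))` is Montgomery–Vaughan Thm. 6.9 (6.12) (`Literature.NumberTheory.LFunctions.ChebyshevPsiDeLaValleePoussin`,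
a named fact in `PrimeNumberTheoremErrorTerm.lean`, which implies the present statement but is not
needed for it).

## The argument

Titchmarsh, *The Theory of the Riemann Zeta-Function*, §3.7, proves `π(x) ∼ x/log x` by writing a
twice-integrated prime-counting function as an absolutely convergent Mellin integral of `ζ'/ζ`-data
over the line `σ = 1`, using the bounds (3.6.5)–(3.6.7) near `σ = 1`, the Riemann–Lebesgue lemma,
and an elementary unsmoothing lemma. We run the same scheme with the Riesz mean
`ψ₁(x) = ∑_{n ≤ x} Λ(n)(x - n)` and quantify each step:

1. `rieszMean_sub_mainTerm_eq` — for `σ > 1`, `x ≥ 1`: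
   `ψ₁(x) - (x-1)²/2 = -(1/2π) ∫ x^{1+s} Φ(s) dt`, `s = σ + it`, `Φ(s) = (ζ₁'/ζ₁)(s)/(s(s+1))`,
   where `ζ₁(s) = (s-1)ζ(s)` is Mathlib's entire `riemannZeta₁` (so `ζ₁'/ζ₁ = ζ'/ζ + 1/(s-1)` is
   holomorphic on `σ ≥ 1`): the tree's Perron formula for the Riesz mean
   (`Literature.NumberTheory.LFunctions.rieszMean_vonMangoldt_eq_integral`, `RieszMeanPerron.lean`) minus the main term, which is
   evaluated by Mellin inversion of `1/((s-1)s(s+1)) ↔ (1-y)²/(2y)·𝟙_{(0,1]}` (`integral_mainTerm_eq`).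
2. `exists_bound_iteratedDeriv` — `‖Φ^{(m)}(σ+it)‖ ≤ C_m (1+|t|)^{-3/2}` uniformly in
   `1 ≤ σ ≤ 3/2`: Cauchy's estimate on discs of radius `≍ log⁻⁹(|t|+5)` inside the zero-free region
   of Titchmarsh (3.6.5), where `‖ζ₁'/ζ₁‖ ≪ log⁹|t|` ((3.6.6), `ZetaOneLineBounds.lean`), and a
   compactness argument near the real axis.
3. `integral_cpow_mul_Phi_eq_pow`, `norm_integral_cpow_mul_Phi_le` — `m` integrations by parts
   along the line (in place of Riemann–Lebesgue): `∫ x^{1+s}Φ dt = (-1/log x)^m ∫ x^{1+s}Φ^{(m)} dt`,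
   whence `|ψ₁(x) - (x-1)²/2| ≤ C_m x²/(log x)^m` on `σ = 1 + 1/log x`
   (`abs_rieszMean_sub_mainTerm_le`).
4. `chebyshevPsi_sub_self_isBigO_div_logPow` — unsmoothing over windows `h = x/(log x)^a`,
   `m = 2a`, via `(y-x)ψ(x) ≤ ψ₁(y) - ψ₁(x) ≤ (y-x)ψ(y)`.

## Design notes

* Only theorems; `Φ` is written out as the lambda
  `fun z ↦ deriv riemannZeta₁ z / riemannZeta₁ z * (1 / (z * (z + 1)))` throughout (no auxiliary
  definitions), and all constants are existentially quantified (`∃ C`).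
* Namespace `Literature.PsiLogPower`.

## References

* E. C. Titchmarsh, *The Theory of the Riemann Zeta-Function*, 2nd ed. (rev. D. R. Heath-Brown),
  Oxford 1986, §3.6 ((3.6.5)–(3.6.7)), §3.7 (`Titchmarsh1986`).
* H. L. Montgomery, R. C. Vaughan, *Multiplicative Number Theory I*, CUP 2007, §5.1, (5.17)–(5.19)
  (Cesàro weights, `k = 1`: the Perron formula for `ψ₁`), Thm. 6.9 (`MontgomeryVaughan2007`).
-/

noncomputable section

open Complex Filter Topology Set MeasureTheory Asymptotics

namespace Literature.NumberTheory.LFunctions.PsiLogPower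

open Real MeasureTheory Set Filter
open scoped Topology ArithmeticFunction.vonMangoldt

/-! ## The Mellin pair `(1-y)²/(2y) · 𝟙_{(0,1]} ↔ 1/((s-1)s(s+1))` and the main term -/

/-- The Mellin transform of `h(y) = (y⁻¹ - 2 + y)/2 · 𝟙_{(0,1]}(y) = (1-y)²/(2y) · 𝟙_{(0,1]}(y)` is
`1/((s-1)s(s+1))` for `Re s > 1`. [folklore] -/
theorem hasMellin_kernel {s : ℂ} (hs : 1 < s.re) :
    HasMellin ((Ioc 0 1).indicator fun y : ℝ ↦ (((y : ℂ) ^ (-1 : ℂ) - 2 + y) / 2))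
      s (1 / ((s - 1) * s * (s + 1))) := by
  have h1 := hasMellin_cpow_Ioc (-1) (s := s) (by simp; linarith)
  have h2 := hasMellin_one_Ioc (s := s) (by linarith)
  have h3 := hasMellin_cpow_Ioc 1 (s := s) (by simp; linarith)
  have hs0 : s ≠ 0 := by rintro rfl; norm_num at hs
  have hs1 : s - 1 ≠ 0 := by
    intro h; have := congrArg Complex.re h; simp at this; linarith
  have hs2 : s + 1 ≠ 0 := by
    intro h; have := congrArg Complex.re h; simp at this; linarith
  have hA := hasMellin_const_smul h2.1 (2 : ℂ)
  have hB := hasMellin_sub h1.1 hA.1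
  have hC := hasMellin_add hB.1 h3.1
  have hD := hasMellin_const_smul hC.1 (1 / 2 : ℂ)
  rw [hC.2, hB.2, hA.2, h1.2, h2.2, h3.2, show s + -1 = s - 1 by ring] at hD
  have hfun : (fun t : ℝ ↦ (1 / 2 : ℂ) • ((Ioc 0 1).indicator (fun t : ℝ ↦ (t : ℂ) ^ (-1 : ℂ)) t -
      (2 : ℂ) • (Ioc 0 1).indicator (fun _ : ℝ ↦ (1 : ℂ)) t +
        (Ioc 0 1).indicator (fun t : ℝ ↦ (t : ℂ) ^ (1 : ℂ)) t)) =
      (Ioc 0 1).indicator fun y : ℝ ↦ (((y : ℂ) ^ (-1 : ℂ) - 2 + y) / 2) := by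
    funext t
    by_cases ht : t ∈ Ioc (0 : ℝ) 1
    · simp only [indicator_of_mem ht, cpow_one, smul_eq_mul]
      ring
    · simp only [indicator_of_notMem ht, smul_zero, sub_zero, add_zero]
  rw [hfun] at hD
  refine ⟨hD.1, ?_⟩
  rw [hD.2]
  simp only [smul_eq_mul]
  field_simp
  ring

/-- Vertical integrability of `1/((s-1)s(s+1))` on `Re s = σ > 1` (it is `≪ 1/((σ-1)(σ²+t²))`).
[folklore] -/
theorem integrable_mainKernel {σ : ℝ} (hσ : 1 < σ) :
    Integrable fun t : ℝ ↦ 1 / (((σ : ℂ) + t * I - 1) * ((σ : ℂ) + t * I) * ((σ : ℂ) + t * I + 1)) := by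
  have hσ0 : 0 < σ := by linarith
  have hK := Literature.NumberTheory.LFunctions.integrable_kernel hσ0
  refine (hK.norm.const_mul (1 / (σ - 1))).mono' ?_ (Eventually.of_forall fun t ↦ ?_)
  · refine Continuous.aestronglyMeasurable ?_
    refine Continuous.div continuous_const (by fun_prop) fun t ↦ ?_
    refine mul_ne_zero (mul_ne_zero ?_ ?_) ?_ <;>
    · intro h; have := congrArg Complex.re h; simp at this; linarith
  · have hs1 : σ - 1 ≤ ‖(σ : ℂ) + t * I - 1‖ := by
      have := abs_re_le_norm ((σ : ℂ) + t * I - 1)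
      simp at this
      rwa [abs_of_pos (by linarith)] at this
    have hsplit : (1 : ℂ) / (((σ : ℂ) + t * I - 1) * ((σ : ℂ) + t * I) * ((σ : ℂ) + t * I + 1)) =
        1 / ((σ : ℂ) + t * I - 1) * (1 / (((σ : ℂ) + t * I) * ((σ : ℂ) + t * I + 1))) := by
      rw [mul_assoc, one_div_mul_one_div]
    rw [hsplit, norm_mul]
    gcongr
    rw [norm_div, norm_one]
    exact one_div_le_one_div_of_le (by linarith) hs1

/-- **Perron kernel for the main term.** For `σ > 1` and `y > 0`,
`(1/2πi) ∫_{(σ)} y^{-s} ds/((s-1)s(s+1)) = (1-y)²/(2y)` for `0 < y ≤ 1` and `= 0` for `y ≥ 1`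
(Mellin inversion, Mathlib `mellinInv_mellin_eq`; cf. Titchmarsh §3.7, where the analogous main term
`x - log x - 1` of `h(x)` is "the sum of the residues on the left of the line"). [folklore] -/
theorem mellinInv_mainKernel_eq {σ : ℝ} (hσ : 1 < σ) {y : ℝ} (hy : 0 < y) :
    mellinInv σ (fun s ↦ 1 / ((s - 1) * s * (s + 1))) y =
      (((max (1 - y) 0) ^ 2 / (2 * y) : ℝ) : ℂ) := by
  set f : ℝ → ℂ := (Ioc 0 1).indicator fun y : ℝ ↦ (((y : ℂ) ^ (-1 : ℂ) - 2 + y) / 2) with hf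
  have hmel : ∀ t : ℝ, mellin f (σ + t * I) =
      1 / (((σ : ℂ) + t * I - 1) * ((σ : ℂ) + t * I) * ((σ : ℂ) + t * I + 1)) := fun t ↦
    (hasMellin_kernel (s := σ + t * I) (by simpa using hσ)).2
  have hconv : MellinConvergent f σ := (hasMellin_kernel (s := σ) (by simpa using hσ)).1
  have hvert : VerticalIntegrable (mellin f) σ := by
    unfold VerticalIntegrable
    exact (integrable_mainKernel hσ).congr (Eventually.of_forall fun t ↦ (hmel t).symm)
  -- `f` agrees on `(0, ∞)` with the continuous function `u ↦ (max (1-u) 0)² / (2u)`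
  have hfeq : ∀ u : ℝ, 0 < u → f u = (((max (1 - u) 0) ^ 2 / (2 * u) : ℝ) : ℂ) := by
    intro u hu
    have hu0 : (u : ℂ) ≠ 0 := ofReal_ne_zero.mpr hu.ne'
    by_cases hu1 : u ≤ 1
    · rw [hf, indicator_of_mem (show u ∈ Ioc (0 : ℝ) 1 from ⟨hu, hu1⟩),
        max_eq_left (by linarith), cpow_neg_one]
      push_cast
      field_simp
      ring
    · rw [hf, indicator_of_notMem (show u ∉ Ioc (0 : ℝ) 1 from fun h ↦ hu1 h.2),
        max_eq_right (by linarith)]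
      simp
  have hcont : ContinuousAt f y := by
    have hev : f =ᶠ[𝓝 y] fun u ↦ (((max (1 - u) 0) ^ 2 / (2 * u) : ℝ) : ℂ) := by
      filter_upwards [Ioi_mem_nhds hy] with u hu
      exact hfeq u hu
    refine ContinuousAt.congr ?_ hev.symm
    refine (Complex.continuous_ofReal.continuousAt).comp ?_
    refine ContinuousAt.div (by fun_prop) (by fun_prop) (by positivity)
  have hinv := mellinInv_mellin_eq σ f hy hconv hvert hcont
  rw [hfeq y hy] at hinv
  rw [← hinv]
  unfold mellinInv
  congr 1
  refine integral_congr_ae (Eventually.of_forall fun t ↦ ?_)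
  simp only [hmel t]

/-- **The main term.** For `x ≥ 1` and `σ > 1`,
`(1/2π) ∫ x^{1+σ+it} dt/((s-1)s(s+1)) = (x-1)²/2` (`s = σ+it`), i.e. `x · h(1/x)` with
`h(y) = (1-y)²/(2y)` the Mellin partner of `1/((s-1)s(s+1))`. [folklore] -/
theorem integral_mainTerm_eq {x : ℝ} (hx : 1 ≤ x) {σ : ℝ} (hσ : 1 < σ) :
    (1 / (2 * π) : ℂ) * ∫ t : ℝ, (x : ℂ) ^ (1 + (σ + t * I)) *
      (1 / (((σ : ℂ) + t * I - 1) * ((σ : ℂ) + t * I) * ((σ : ℂ) + t * I + 1))) =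
      ((((x - 1) ^ 2 / 2 : ℝ)) : ℂ) := by
  have hx0 : 0 < x := by linarith
  have hxC : (x : ℂ) ≠ 0 := ofReal_ne_zero.mpr hx0.ne'
  have hK := mellinInv_mainKernel_eq hσ (y := x⁻¹) (by positivity)
  unfold mellinInv at hK
  have hmax : max (1 - x⁻¹) 0 = 1 - x⁻¹ := max_eq_left (by
    have : x⁻¹ ≤ 1 := inv_le_one_of_one_le₀ hx
    linarith)
  rw [hmax] at hK
  have hval : (((1 - x⁻¹) ^ 2 / (2 * x⁻¹) : ℝ) : ℂ) * x = ((((x - 1) ^ 2 / 2 : ℝ)) : ℂ) := by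
    have : (1 - x⁻¹) ^ 2 / (2 * x⁻¹) * x = (x - 1) ^ 2 / 2 := by
      field_simp
    exact_mod_cast this
  rw [← hval, ← hK]
  -- `(x⁻¹)^{-s} = x^{s}` and `x^{1+s} = x^s · x`
  have hpow : ∀ t : ℝ, (((x⁻¹ : ℝ)) : ℂ) ^ (-((σ : ℂ) + t * I)) = (x : ℂ) ^ ((σ : ℂ) + t * I) := by
    intro t
    rw [ofReal_inv, inv_cpow _ _ ?_, cpow_neg, inv_inv]
    rw [arg_ofReal_of_nonneg hx0.le]; exact Real.pi_pos.ne
  rw [Complex.real_smul, show ((1 / (2 * π) : ℝ) : ℂ) = (1 / (2 * π) : ℂ) by push_cast; ring,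
    mul_assoc]
  congr 1
  rw [← integral_mul_const]
  refine integral_congr_ae (Eventually.of_forall fun t ↦ ?_)
  simp only [smul_eq_mul]
  rw [hpow t, cpow_add _ _ hxC, cpow_one]
  ring

/-- On `Re s > 1`: `-ζ'(s)/ζ(s) = 1/(s-1) - ζ₁'(s)/ζ₁(s)`. [folklore] -/
theorem neg_logDeriv_zeta_eq {s : ℂ} (hs : 1 < s.re) :
    -deriv riemannZeta s / riemannZeta s =
      1 / (s - 1) - deriv riemannZeta₁ s / riemannZeta₁ s := by
  have hs1 : s ≠ 1 := by
    intro h; rw [h] at hs; simp at hs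
  have hζ : riemannZeta s ≠ 0 := riemannZeta_ne_zero_of_one_lt_re hs
  rw [Literature.NumberTheory.LFunctions.ZetaOneLine.deriv_riemannZeta₁_eq hs1, Literature.NumberTheory.LFunctions.riemannZeta₁_eq_mul hs1]
  field_simp [sub_ne_zero.mpr hs1, hζ]
  ring

/-- Continuity of `t ↦ ζ₁'(σ+it)/ζ₁(σ+it)` for `σ > 1`. [folklore] -/
theorem continuous_logDeriv_zeta₁_vertical {σ : ℝ} (hσ : 1 < σ) :
    Continuous fun t : ℝ ↦
      deriv riemannZeta₁ (σ + t * I) / riemannZeta₁ (σ + t * I) := by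
  have hpath : Continuous fun t : ℝ ↦ ((σ : ℂ) + t * I) := by fun_prop
  have hne : ∀ t : ℝ, riemannZeta₁ ((σ : ℂ) + t * I) ≠ 0 := fun t ↦
    Literature.NumberTheory.LFunctions.ZetaOneLine.riemannZeta₁_ne_zero_of_one_le_re (by simp; linarith)
  refine Continuous.div ?_ (differentiable_riemannZeta₁.continuous.comp hpath) hne
  refine continuous_iff_continuousAt.2 fun t ↦ ?_
  exact ((differentiable_riemannZeta₁.analyticAt _).deriv.continuousAt).comp
    (f := fun t : ℝ ↦ ((σ : ℂ) + t * I)) hpath.continuousAt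

/-- **The remainder formula.** For `x ≥ 1` and `σ > 1`, with `ψ₁(x) = ∑_{n ≤ x} Λ(n)(x - n)`,
`ψ₁(x) - (x-1)²/2 = -(1/2π) ∫ x^{1+s} (ζ₁'/ζ₁)(s) ds/(s(s+1))` (`s = σ + it`), the integral
converging absolutely: Perron's formula for the Riesz mean (tree,
`Literature.NumberTheory.LFunctions.rieszMean_vonMangoldt_eq_integral`) with `-ζ'/ζ = 1/(s-1) - ζ₁'/ζ₁` and the main term
`integral_mainTerm_eq` (cf. Titchmarsh §3.7, who works with `h(x) = ∫₀^x g(u) du/u`,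
`g(x) = ∫₀^x π(u) log u du/u` and the kernel `x^s/s²` instead of `ψ₁` and `x^{1+s}/(s(s+1))`).
[folklore] -/
theorem rieszMean_sub_mainTerm_eq {x : ℝ} (hx : 1 ≤ x) {σ : ℝ} (hσ : 1 < σ) :
    Integrable (fun t : ℝ ↦ (x : ℂ) ^ (1 + (σ + t * I)) *
      (deriv riemannZeta₁ (σ + t * I) / riemannZeta₁ (σ + t * I)) *
        (1 / ((σ + t * I) * (σ + t * I + 1)))) ∧
    (((∑ n ∈ Finset.Ioc 0 ⌊x⌋₊, (Λ n : ℝ) * (x - n)) - (x - 1) ^ 2 / 2 : ℝ) : ℂ) =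
      -(1 / (2 * π) : ℂ) * ∫ t : ℝ, (x : ℂ) ^ (1 + (σ + t * I)) *
        (deriv riemannZeta₁ (σ + t * I) / riemannZeta₁ (σ + t * I)) *
          (1 / ((σ + t * I) * (σ + t * I + 1))) := by
  have hx0 : 0 < x := by linarith
  have hxC : (x : ℂ) ≠ 0 := ofReal_ne_zero.mpr hx0.ne'
  have hσ0 : 0 < σ := by linarith
  have hre : ∀ t : ℝ, 1 < ((σ : ℂ) + t * I).re := fun t ↦ by simpa using hσ
  -- the three integrands
  set fZ : ℝ → ℂ := fun t ↦ (x : ℂ) ^ (1 + (σ + t * I)) *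
    (-deriv riemannZeta (σ + t * I) / riemannZeta (σ + t * I)) *
      (1 / ((σ + t * I) * (σ + t * I + 1))) with hfZ
  set fM : ℝ → ℂ := fun t ↦ (x : ℂ) ^ (1 + (σ + t * I)) *
    (1 / (((σ : ℂ) + t * I - 1) * ((σ : ℂ) + t * I) * ((σ : ℂ) + t * I + 1))) with hfM
  set fF : ℝ → ℂ := fun t ↦ (x : ℂ) ^ (1 + (σ + t * I)) *
    (deriv riemannZeta₁ (σ + t * I) / riemannZeta₁ (σ + t * I)) *
      (1 / ((σ + t * I) * (σ + t * I + 1))) with hfF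
  have hnormx : ∀ t : ℝ, ‖(x : ℂ) ^ (1 + ((σ : ℂ) + t * I))‖ = x ^ (1 + σ) := by
    intro t; rw [norm_cpow_eq_rpow_re_of_pos hx0]; simp
  have hcontx : Continuous fun t : ℝ ↦ (x : ℂ) ^ (1 + ((σ : ℂ) + t * I)) := by
    refine continuous_iff_continuousAt.2 fun t ↦ ?_
    exact (continuousAt_const_cpow hxC).comp (f := fun t : ℝ ↦ 1 + ((σ : ℂ) + t * I))
      (by fun_prop)
  have hintZ : Integrable fZ := Literature.NumberTheory.LFunctions.integrable_rieszIntegrand hx0 hσ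
  have hintM : Integrable fM := by
    refine (integrable_mainKernel hσ).bdd_mul (c := x ^ (1 + σ)) hcontx.aestronglyMeasurable
      (Eventually.of_forall fun t ↦ (hnormx t).le)
  have hsplit : ∀ t : ℝ, fF t = fM t - fZ t := by
    intro t
    simp only [hfF, hfM, hfZ]
    rw [neg_logDeriv_zeta_eq (hre t)]
    have hK3 : (1 : ℂ) / (((σ : ℂ) + t * I - 1) * ((σ : ℂ) + t * I) * ((σ : ℂ) + t * I + 1)) =
        1 / ((σ : ℂ) + t * I - 1) * (1 / (((σ : ℂ) + t * I) * ((σ : ℂ) + t * I + 1))) := by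
      rw [mul_assoc, one_div_mul_one_div]
    rw [hK3]
    ring
  have hintF : Integrable fF := (hintM.sub hintZ).congr (Eventually.of_forall fun t ↦ (hsplit t).symm)
  refine ⟨hintF, ?_⟩
  have hψ := Literature.NumberTheory.LFunctions.rieszMean_vonMangoldt_eq_integral hx0 hσ
  have hmain := integral_mainTerm_eq hx hσ
  rw [ofReal_sub, hψ, ← hmain]
  change (1 / (2 * π) : ℂ) * (∫ t, fZ t) - (1 / (2 * π) : ℂ) * (∫ t, fM t) =
    -(1 / (2 * π) : ℂ) * ∫ t, fF t
  rw [integral_congr_ae (Eventually.of_forall hsplit), integral_sub hintM hintZ]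
  ring

/-! ## Zero-free discs around the lines `Re s = σ ∈ [1, 3/2]` and Cauchy bounds for `Φ` -/

/-- Discs of radius `1/(1024 K log⁹|t|)` about `σ + it`, `1 ≤ σ ≤ 3/2`, `|t| ≥ 5`, lie in the
zero-free region of Titchmarsh (3.6.5): on them `ζ₁ ≠ 0` and `‖ζ₁'/ζ₁‖ ≤ 1536 K log⁹|t|`
(`K = 1134·16·336⁴`). [folklore] -/
theorem disc_large {σ t : ℝ} (hσ1 : 1 ≤ σ) (hσ2 : σ ≤ 3 / 2) (ht : 5 ≤ |t|) {z : ℂ}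
    (hz : z ∈ Metric.closedBall ((σ : ℂ) + t * I)
      (1 / (1024 * (1134 * 16 * 336 ^ 4) * Real.log |t| ^ 9))) :
    riemannZeta₁ z ≠ 0 ∧ 1 / 2 ≤ z.re ∧
      ‖deriv riemannZeta₁ z / riemannZeta₁ z‖ ≤ 1536 * (1134 * 16 * 336 ^ 4) * Real.log |t| ^ 9 := by
  set K : ℝ := 1134 * 16 * 336 ^ 4 with hKdef
  have hK1 : 1 ≤ K := Literature.NumberTheory.LFunctions.ZetaOneLine.one_le_K
  set L := Real.log |t| with hLdef
  have hL : 1 < L := Literature.NumberTheory.LFunctions.MertensBound.one_lt_log_three.trans_le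
    (Real.log_le_log (by norm_num) (le_trans (by norm_num) ht))
  have hL0 : 0 < L := by linarith
  set r := 1 / (1024 * K * L ^ 9) with hrdef
  have hr0 : 0 < r := by positivity
  have hr1 : r ≤ 1 / 1024 := by
    rw [hrdef, div_le_div_iff₀ (by positivity) (by norm_num), one_mul, one_mul]
    calc (1024 : ℝ) = 1024 * 1 * 1 ^ 9 := by norm_num
      _ ≤ 1024 * K * L ^ 9 := by gcongr
  rw [Metric.mem_closedBall, dist_eq_norm] at hz
  have him : |z.im - t| ≤ r := by
    have := abs_im_le_norm (z - (σ + t * I)); simp at this; exact this.trans hz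
  have hre : |z.re - σ| ≤ r := by
    have := abs_re_le_norm (z - (σ + t * I)); simp at this; exact this.trans hz
  have hzim1 : |t| - r ≤ |z.im| := by
    have := abs_sub_abs_le_abs_sub t z.im; rw [abs_sub_comm] at him; linarith
  have hzim2 : |z.im| ≤ |t| + r := by
    have := abs_sub_abs_le_abs_sub z.im t; linarith
  have hz4 : 4 ≤ |z.im| := by linarith
  have hzre1 : σ - r ≤ z.re := by have := neg_abs_le (z.re - σ); linarith
  have hzre2 : z.re ≤ σ + r := by have := le_abs_self (z.re - σ); linarith
  have hlogz : Real.log |z.im| ≤ 2 * L := by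
    calc Real.log |z.im| ≤ Real.log (|t| + 1) := Real.log_le_log (by linarith) (by linarith)
      _ ≤ 2 * L := Literature.NumberTheory.LFunctions.ZetaOneLine.log_abs_add_one_le (le_trans (by norm_num) ht)
  have hlogz0 : 0 < Real.log |z.im| := lt_trans zero_lt_one
    (Literature.NumberTheory.LFunctions.MertensBound.one_lt_log_three.trans_le (Real.log_le_log (by norm_num) (by linarith)))
  have hlogz9 : Real.log |z.im| ^ 9 ≤ 512 * L ^ 9 := by
    calc Real.log |z.im| ^ 9 ≤ (2 * L) ^ 9 := by gcongr
      _ = 512 * L ^ 9 := by ring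
  -- the region hypotheses
  have hreg : 1 - 1 / (2 * (1134 * 16 * 336 ^ 4) * Real.log |z.im| ^ 9) ≤ z.re := by
    rw [← hKdef]
    have h1 : r ≤ 1 / (2 * K * Real.log |z.im| ^ 9) := by
      rw [hrdef]
      refine one_div_le_one_div_of_le (by positivity) ?_
      calc 2 * K * Real.log |z.im| ^ 9 ≤ 2 * K * (512 * L ^ 9) := by gcongr
        _ = 1024 * K * L ^ 9 := by ring
    linarith
  have hreg2 : z.re ≤ 2 := by linarith
  refine ⟨Literature.NumberTheory.LFunctions.ZetaOneLine.riemannZeta₁_ne_zero_of_re_ge hz4 hreg hreg2, by linarith, ?_⟩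
  calc ‖deriv riemannZeta₁ z / riemannZeta₁ z‖
      ≤ 3 * (1134 * 16 * 336 ^ 4) * Real.log |z.im| ^ 9 :=
        Literature.NumberTheory.LFunctions.ZetaOneLine.norm_logDeriv_riemannZeta₁_le hz4 hreg hreg2
    _ ≤ 3 * (1134 * 16 * 336 ^ 4) * (512 * L ^ 9) := by gcongr
    _ = 1536 * (1134 * 16 * 336 ^ 4) * L ^ 9 := by ring

/-- Near the real axis, by compactness: there are `δ ∈ (0, 1/2]` and `B` such that the closed
`δ`-discs about `σ + it`, `1 ≤ σ ≤ 3/2`, `|t| ≤ 6`, avoid the zeros of `ζ₁` and carry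
`‖ζ₁'/ζ₁‖ ≤ B` (`ζ₁ ≠ 0` on `Re s ≥ 1`, an open condition). [folklore] -/
theorem disc_small : ∃ δ : ℝ, 0 < δ ∧ δ ≤ 1 / 2 ∧ ∃ B : ℝ, 0 ≤ B ∧
    ∀ σ t : ℝ, 1 ≤ σ → σ ≤ 3 / 2 → |t| ≤ 6 →
      ∀ z ∈ Metric.closedBall ((σ : ℂ) + t * I) δ,
        riemannZeta₁ z ≠ 0 ∧ ‖deriv riemannZeta₁ z / riemannZeta₁ z‖ ≤ B := by
  set R₀ : Set ℂ := Icc (1 : ℝ) (3 / 2) ×ℂ Icc (-6 : ℝ) 6 with hR₀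
  have hR₀c : IsCompact R₀ := isCompact_Icc.reProdIm isCompact_Icc
  set U : Set ℂ := {z | riemannZeta₁ z ≠ 0} with hU
  have hUo : IsOpen U := isOpen_ne_fun differentiable_riemannZeta₁.continuous continuous_const
  have hsub : R₀ ⊆ U := by
    intro z hz
    rw [hR₀, mem_reProdIm] at hz
    exact Literature.NumberTheory.LFunctions.ZetaOneLine.riemannZeta₁_ne_zero_of_one_le_re hz.1.1
  obtain ⟨δ, hδ0, hδU⟩ := hR₀c.exists_cthickening_subset_open hUo hsub
  set δ₀ := min δ (1 / 2) with hδ₀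
  have hδ₀0 : 0 < δ₀ := lt_min hδ0 (by norm_num)
  have hthick : Metric.cthickening δ₀ R₀ ⊆ U :=
    (Metric.cthickening_mono (min_le_left _ _) R₀).trans hδU
  have hcomp : IsCompact (Metric.cthickening δ₀ R₀) := hR₀c.cthickening
  have hcont : ContinuousOn (fun z ↦ deriv riemannZeta₁ z / riemannZeta₁ z)
      (Metric.cthickening δ₀ R₀) := by
    refine ContinuousOn.div ?_ differentiable_riemannZeta₁.continuous.continuousOn
      fun z hz ↦ hthick hz
    exact ((differentiable_riemannZeta₁.contDiff (n := 1)).continuous_deriv le_rfl).continuousOn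
  obtain ⟨B, hB⟩ := hcomp.exists_bound_of_continuousOn hcont
  refine ⟨δ₀, hδ₀0, min_le_right _ _, max B 0, le_max_right _ _, ?_⟩
  intro σ t hσ1 hσ2 ht z hz
  have hc : ((σ : ℂ) + t * I) ∈ R₀ := by
    rw [hR₀, mem_reProdIm]
    constructor
    · simp; exact ⟨hσ1, hσ2⟩
    · simp; exact abs_le.mp ht
  have hz' : z ∈ Metric.cthickening δ₀ R₀ := Metric.closedBall_subset_cthickening hc δ₀ hz
  exact ⟨hthick hz', (hB z hz').trans (le_max_left _ _)⟩

/-- **Zero-free discs, all heights.** There are `δ ∈ (0, 1/2]` and `B ≥ 0` such that for all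
`1 ≤ σ ≤ 3/2` and all real `t`, on the closed disc about `σ + it` of radius
`r(t) = min δ (1/(1024 K log⁹(|t|+5)))` one has `ζ₁ ≠ 0`, `Re ≥ 1/2` and
`‖ζ₁'/ζ₁‖ ≤ 1536 K log⁹(|t|+5) + B`. [folklore] -/
theorem disc_all : ∃ δ : ℝ, 0 < δ ∧ δ ≤ 1 / 2 ∧ ∃ B : ℝ, 0 ≤ B ∧
    ∀ σ t : ℝ, 1 ≤ σ → σ ≤ 3 / 2 →
      ∀ z ∈ Metric.closedBall ((σ : ℂ) + t * I)
        (min δ (1 / (1024 * (1134 * 16 * 336 ^ 4) * Real.log (|t| + 5) ^ 9))),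
        riemannZeta₁ z ≠ 0 ∧ 1 / 2 ≤ z.re ∧
          ‖deriv riemannZeta₁ z / riemannZeta₁ z‖ ≤
            1536 * (1134 * 16 * 336 ^ 4) * Real.log (|t| + 5) ^ 9 + B := by
  obtain ⟨δ, hδ0, hδ2, B, hB0, H⟩ := disc_small
  refine ⟨δ, hδ0, hδ2, B, hB0, fun σ t hσ1 hσ2 z hz ↦ ?_⟩
  set K : ℝ := 1134 * 16 * 336 ^ 4 with hKdef
  have hK1 : 1 ≤ K := Literature.NumberTheory.LFunctions.ZetaOneLine.one_le_K
  set Lt := Real.log (|t| + 5) with hLt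
  have hLt1 : 1 < Lt := Literature.NumberTheory.LFunctions.MertensBound.one_lt_log_three.trans_le
    (Real.log_le_log (by norm_num) (by linarith [abs_nonneg t]))
  have hLt9 : 0 ≤ 1536 * K * Lt ^ 9 := by positivity
  rw [Metric.mem_closedBall] at hz
  by_cases ht : |t| ≤ 5
  · have hz' : z ∈ Metric.closedBall ((σ : ℂ) + t * I) δ :=
      Metric.mem_closedBall.mpr (hz.trans (min_le_left _ _))
    obtain ⟨h1, h2⟩ := H σ t hσ1 hσ2 (by linarith) z hz'
    refine ⟨h1, ?_, h2.trans (by linarith)⟩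
    rw [Metric.mem_closedBall, dist_eq_norm] at hz'
    have := abs_re_le_norm (z - (σ + t * I)); simp at this
    have := neg_abs_le (z.re - σ)
    linarith
  · push Not at ht
    have hL0 : 0 < Real.log |t| := Real.log_pos (by linarith)
    have hLLt : Real.log |t| ≤ Lt := Real.log_le_log (by linarith) (by linarith)
    have hr : min δ (1 / (1024 * K * Lt ^ 9)) ≤ 1 / (1024 * K * Real.log |t| ^ 9) := by
      refine (min_le_right _ _).trans ?_
      exact one_div_le_one_div_of_le (by positivity) (by gcongr)
    have hz' : z ∈ Metric.closedBall ((σ : ℂ) + t * I) (1 / (1024 * K * Real.log |t| ^ 9)) :=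
      Metric.mem_closedBall.mpr (hz.trans hr)
    obtain ⟨h1, h2, h3⟩ := disc_large hσ1 hσ2 ht.le hz'
    refine ⟨h1, h2, h3.trans ?_⟩
    calc 1536 * (1134 * 16 * 336 ^ 4) * Real.log |t| ^ 9 ≤ 1536 * K * Lt ^ 9 := by
          rw [hKdef]; gcongr
      _ ≤ 1536 * K * Lt ^ 9 + B := by linarith

/-- The kernel on such a disc: if `Re z ≥ 1/2` and `‖z - (σ+it)‖ ≤ 1/2` then
`‖1/(z(z+1))‖ ≤ 8/(1+t²)`. [folklore] -/
theorem norm_kernel_le_of_mem_disc {σ t : ℝ} {z : ℂ} (hre : 1 / 2 ≤ z.re)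
    (hz : ‖z - ((σ : ℂ) + t * I)‖ ≤ 1 / 2) : ‖1 / (z * (z + 1))‖ ≤ 8 / (1 + t ^ 2) := by
  have him : |z.im - t| ≤ 1 / 2 := by
    have := abs_im_le_norm (z - (σ + t * I)); simp at this; exact this.trans hz
  have hnz : (1 + t ^ 2) / 8 ≤ Complex.normSq z := by
    rw [Complex.normSq_apply]
    have hre2 : 1 / 4 ≤ z.re * z.re := by nlinarith
    by_cases ht : |t| ≤ 1
    · have : t ^ 2 ≤ 1 := by nlinarith [abs_nonneg t, sq_abs t]
      nlinarith [mul_self_nonneg z.im]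
    · push Not at ht
      have h1 : |t| / 2 ≤ |z.im| := by
        have := abs_sub_abs_le_abs_sub t z.im
        rw [abs_sub_comm] at him
        linarith
      have h2 : t ^ 2 / 4 ≤ z.im * z.im := by
        have h0 : 0 ≤ |t| / 2 := by positivity
        have := mul_le_mul h1 h1 h0 (abs_nonneg _)
        rw [← sq_abs t]
        nlinarith [abs_mul_abs_self z.im]
      nlinarith
  have hz0 : z ≠ 0 := by
    intro h; rw [h] at hre; simp at hre; linarith
  have hnz1 : Complex.normSq z ≤ Complex.normSq (z + 1) := by
    rw [Complex.normSq_apply, Complex.normSq_apply]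
    simp
    nlinarith
  have hpos : 0 < Complex.normSq z := Complex.normSq_pos.mpr hz0
  rw [norm_div, norm_one, norm_mul, div_le_div_iff₀ (by
    refine mul_pos (norm_pos_iff.mpr hz0) (norm_pos_iff.mpr ?_)
    intro h; rw [Complex.normSq_eq_norm_sq, Complex.normSq_eq_norm_sq, h] at hnz1
    simp at hnz1; exact hz0 hnz1) (by positivity), one_mul]
  have h3 : ‖z‖ ^ 2 ≤ ‖z‖ * ‖z + 1‖ := by
    rw [sq]
    refine mul_le_mul_of_nonneg_left ?_ (norm_nonneg _)
    rw [← Real.sqrt_le_sqrt_iff (Complex.normSq_nonneg _)] at hnz1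
    simpa [Complex.norm_def] using hnz1
  rw [← Complex.normSq_eq_norm_sq] at h3
  nlinarith

/-- **Cauchy's estimate for `Φ = (ζ₁'/ζ₁)(s) / (s(s+1))`** on the zero-free discs of `disc_all`:
`‖Φ^{(m)}(σ+it)‖ ≤ m! · (8(1536K log⁹(|t|+5) + B)/(1+t²)) / r(t)^m`. [folklore] -/
theorem norm_iteratedDeriv_le_of_disc {δ B : ℝ} (hδ0 : 0 < δ) (hδ2 : δ ≤ 1 / 2) (hB0 : 0 ≤ B)
    (H : ∀ σ t : ℝ, 1 ≤ σ → σ ≤ 3 / 2 →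
      ∀ z ∈ Metric.closedBall ((σ : ℂ) + t * I)
        (min δ (1 / (1024 * (1134 * 16 * 336 ^ 4) * Real.log (|t| + 5) ^ 9))),
        riemannZeta₁ z ≠ 0 ∧ 1 / 2 ≤ z.re ∧
          ‖deriv riemannZeta₁ z / riemannZeta₁ z‖ ≤
            1536 * (1134 * 16 * 336 ^ 4) * Real.log (|t| + 5) ^ 9 + B)
    (m : ℕ) {σ : ℝ} (hσ1 : 1 ≤ σ) (hσ2 : σ ≤ 3 / 2) (t : ℝ) :
    ‖iteratedDeriv m (fun z : ℂ ↦ deriv riemannZeta₁ z / riemannZeta₁ z * (1 / (z * (z + 1))))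
        ((σ : ℂ) + t * I)‖ ≤
      m.factorial * ((1536 * (1134 * 16 * 336 ^ 4) * Real.log (|t| + 5) ^ 9 + B) *
        (8 / (1 + t ^ 2))) /
        (min δ (1 / (1024 * (1134 * 16 * 336 ^ 4) * Real.log (|t| + 5) ^ 9))) ^ m := by
  set K : ℝ := 1134 * 16 * 336 ^ 4 with hKdef
  have hK1 : 1 ≤ K := Literature.NumberTheory.LFunctions.ZetaOneLine.one_le_K
  set Lt := Real.log (|t| + 5) with hLt
  have hLt1 : 1 < Lt := Literature.NumberTheory.LFunctions.MertensBound.one_lt_log_three.trans_le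
    (Real.log_le_log (by norm_num) (by linarith [abs_nonneg t]))
  set r := min δ (1 / (1024 * K * Lt ^ 9)) with hr
  have hr0 : 0 < r := lt_min hδ0 (by positivity)
  have hr2 : r ≤ 1 / 2 := (min_le_left _ _).trans hδ2
  set c : ℂ := (σ : ℂ) + t * I with hc
  have Hc := H σ t hσ1 hσ2
  -- differentiability on the closed disc
  have hdiff : DiffContOnCl ℂ
      (fun z : ℂ ↦ deriv riemannZeta₁ z / riemannZeta₁ z * (1 / (z * (z + 1)))) (Metric.ball c r) := by
    refine DifferentiableOn.diffContOnCl ?_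
    rw [closure_ball c hr0.ne']
    intro z hz
    obtain ⟨h1, h2, -⟩ := Hc z hz
    have hz0 : z ≠ 0 := by intro h; rw [h] at h2; simp at h2; linarith
    have hz1 : z + 1 ≠ 0 := by
      intro h; have := congrArg Complex.re h; simp at this; linarith
    refine DifferentiableAt.differentiableWithinAt ?_
    refine DifferentiableAt.mul (DifferentiableAt.div ?_ ?_ h1) ?_
    · exact (differentiable_riemannZeta₁.analyticAt z).deriv.differentiableAt
    · exact differentiable_riemannZeta₁ z
    · refine DifferentiableAt.div (differentiableAt_const _) ?_ (mul_ne_zero hz0 hz1)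
      fun_prop
  have hbound : ∀ z ∈ Metric.sphere c r,
      ‖deriv riemannZeta₁ z / riemannZeta₁ z * (1 / (z * (z + 1)))‖ ≤
        (1536 * K * Lt ^ 9 + B) * (8 / (1 + t ^ 2)) := by
    intro z hz
    have hz' : z ∈ Metric.closedBall c r := Metric.sphere_subset_closedBall hz
    obtain ⟨-, h2, h3⟩ := Hc z hz'
    rw [Metric.mem_closedBall, dist_eq_norm] at hz'
    rw [norm_mul]
    have hLB : 0 ≤ 1536 * K * Lt ^ 9 + B := by positivity
    exact mul_le_mul h3 (norm_kernel_le_of_mem_disc h2 (hz'.trans hr2)) (norm_nonneg _) hLB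
  have := Complex.norm_iteratedDeriv_le_of_forall_mem_sphere_norm_le m hr0 hdiff hbound
  simpa [div_eq_mul_inv, mul_comm, mul_left_comm, mul_assoc] using this

/-- `1/(min δ b)^m ≤ 1/δ^m + 1/b^m` for positive `δ, b`. [folklore] -/
theorem one_div_min_pow_le {δ b : ℝ} (hδ : 0 < δ) (hb : 0 < b) (m : ℕ) :
    1 / (min δ b) ^ m ≤ 1 / δ ^ m + 1 / b ^ m := by
  rcases min_choice δ b with h | h <;> rw [h]
  · have : 0 ≤ 1 / b ^ m := by positivity
    linarith
  · have : 0 ≤ 1 / δ ^ m := by positivity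
    linarith

/-- Powers of the logarithm are `O(u^{1/2})`: `(log u)^N ≤ (2N)^N u^{1/2}` for `u ≥ 1`, `N ≥ 1`.
[folklore] -/
theorem log_pow_le_rpow_half {N : ℕ} (hN : 1 ≤ N) {u : ℝ} (hu : 1 ≤ u) :
    Real.log u ^ N ≤ (2 * N) ^ N * u ^ (1 / 2 : ℝ) := by
  have hN0 : (0 : ℝ) < N := by exact_mod_cast hN
  set ε : ℝ := 1 / (2 * N) with hε
  have hε0 : 0 < ε := by positivity
  have hlog0 : 0 ≤ Real.log u := Real.log_nonneg hu
  have h1 : Real.log u ≤ u ^ ε / ε := Real.log_le_rpow_div (by linarith) hε0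
  have h2 : Real.log u ^ N ≤ (u ^ ε / ε) ^ N := pow_le_pow_left₀ hlog0 h1 N
  have h3 : (u ^ ε / ε) ^ N = (2 * N) ^ N * u ^ (1 / 2 : ℝ) := by
    rw [div_pow, ← Real.rpow_natCast (u ^ ε) N, ← Real.rpow_mul (by linarith)]
    have : ε * N = 1 / 2 := by rw [hε]; field_simp
    rw [this, hε, one_div_pow, div_div_eq_mul_div, div_one, mul_comm]
  linarith [h3 ▸ h2]

/-- **Integrable majorant for the derivatives of `Φ` on the strip `1 ≤ Re s ≤ 3/2`.** For each `m`
there is `C` with `‖Φ^{(m)}(σ+it)‖ ≤ C (1+|t|)^{-3/2}` for all `1 ≤ σ ≤ 3/2` and all real `t`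
(Cauchy on discs of radius `≍ log⁻⁹(|t|+5)`, so `‖Φ^{(m)}‖ ≪_m log^{9m+9}(|t|+5)/(1+t²)`).
[folklore] -/
theorem exists_bound_iteratedDeriv (m : ℕ) : ∃ C : ℝ, 0 ≤ C ∧
    ∀ σ : ℝ, 1 ≤ σ → σ ≤ 3 / 2 → ∀ t : ℝ,
      ‖iteratedDeriv m (fun z : ℂ ↦ deriv riemannZeta₁ z / riemannZeta₁ z * (1 / (z * (z + 1))))
          ((σ : ℂ) + t * I)‖ ≤ C * (1 + |t|) ^ (-(3 / 2 : ℝ)) := by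
  obtain ⟨δ, hδ0, hδ2, B, hB0, H⟩ := disc_all
  set K : ℝ := 1134 * 16 * 336 ^ 4 with hKdef
  have hK1 : 1 ≤ K := Literature.NumberTheory.LFunctions.ZetaOneLine.one_le_K
  set N : ℕ := 9 * m + 9 with hNdef
  have hN1 : 1 ≤ N := by omega
  -- the constant
  set C : ℝ := m.factorial * (1536 * K + B) * 16 * (1 / δ ^ m + (1024 * K) ^ m) *
    ((2 * N) ^ N * 3) with hCdef
  refine ⟨C, by positivity, fun σ hσ1 hσ2 t ↦ ?_⟩
  have h0 := norm_iteratedDeriv_le_of_disc hδ0 hδ2 hB0 H m hσ1 hσ2 t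
  rw [← hKdef] at h0
  set Lt := Real.log (|t| + 5) with hLt
  have hLt1 : 1 < Lt := Literature.NumberTheory.LFunctions.MertensBound.one_lt_log_three.trans_le
    (Real.log_le_log (by norm_num) (by linarith [abs_nonneg t]))
  have hLt0 : 0 < Lt := by linarith
  have hLt9 : 1 ≤ Lt ^ 9 := one_le_pow₀ hLt1.le
  set u : ℝ := 1 + |t| with hu
  have hu1 : 1 ≤ u := by rw [hu]; linarith [abs_nonneg t]
  have hu0 : 0 < u := by linarith
  -- (i) the log-derivative bound
  have hLD : 1536 * K * Lt ^ 9 + B ≤ (1536 * K + B) * Lt ^ 9 := by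
    calc 1536 * K * Lt ^ 9 + B ≤ 1536 * K * Lt ^ 9 + B * Lt ^ 9 := by
          gcongr; exact le_mul_of_one_le_right hB0 hLt9
      _ = (1536 * K + B) * Lt ^ 9 := by ring
  -- (ii) the radius
  have hrad : 1 / (min δ (1 / (1024 * K * Lt ^ 9))) ^ m ≤
      (1 / δ ^ m + (1024 * K) ^ m) * Lt ^ (9 * m) := by
    have h1 := one_div_min_pow_le hδ0 (b := 1 / (1024 * K * Lt ^ 9)) (by positivity) m
    have h2 : 1 / (1 / (1024 * K * Lt ^ 9)) ^ m = (1024 * K) ^ m * Lt ^ (9 * m) := by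
      rw [one_div_pow, one_div_one_div, mul_pow, ← pow_mul]
    rw [h2] at h1
    refine h1.trans ?_
    rw [add_mul]
    gcongr
    calc 1 / δ ^ m = 1 / δ ^ m * 1 := by ring
      _ ≤ 1 / δ ^ m * Lt ^ (9 * m) := by gcongr; exact one_le_pow₀ hLt1.le
  -- (iii) the logarithm
  have hlog : Lt ^ N ≤ (2 * N) ^ N * 3 * u ^ (1 / 2 : ℝ) := by
    have h1 := log_pow_le_rpow_half hN1 (u := |t| + 5) (by linarith [abs_nonneg t])
    rw [← hLt] at h1
    have h2 : (|t| + 5) ^ (1 / 2 : ℝ) ≤ 3 * u ^ (1 / 2 : ℝ) := by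
      have h9 : (|t| + 5) ≤ 9 * u := by rw [hu]; linarith [abs_nonneg t]
      calc (|t| + 5) ^ (1 / 2 : ℝ) ≤ (9 * u) ^ (1 / 2 : ℝ) :=
            Real.rpow_le_rpow (by positivity) h9 (by norm_num)
        _ = 9 ^ (1 / 2 : ℝ) * u ^ (1 / 2 : ℝ) := Real.mul_rpow (by norm_num) hu0.le
        _ = 3 * u ^ (1 / 2 : ℝ) := by
            congr 1
            rw [show (9 : ℝ) = 3 ^ (2 : ℝ) by norm_num, ← Real.rpow_mul (by norm_num)]
            norm_num
    calc Lt ^ N ≤ (2 * N) ^ N * (|t| + 5) ^ (1 / 2 : ℝ) := h1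
      _ ≤ (2 * N) ^ N * (3 * u ^ (1 / 2 : ℝ)) := by gcongr
      _ = (2 * N) ^ N * 3 * u ^ (1 / 2 : ℝ) := by ring
  -- (iv) the kernel factor
  have hker : 8 / (1 + t ^ 2) ≤ 16 * u ^ (-2 : ℝ) := by
    rw [Real.rpow_neg hu0.le, Real.rpow_two, ← div_eq_mul_inv,
      div_le_div_iff₀ (by positivity) (by positivity), hu, ← sq_abs t]
    nlinarith [abs_nonneg t, sq_nonneg (|t| - 1)]
  -- assembly
  have hfac : (0 : ℝ) ≤ m.factorial := by positivity
  calc ‖iteratedDeriv m (fun z : ℂ ↦ deriv riemannZeta₁ z / riemannZeta₁ z * (1 / (z * (z + 1))))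
          ((σ : ℂ) + t * I)‖
      ≤ m.factorial * ((1536 * K * Lt ^ 9 + B) * (8 / (1 + t ^ 2))) /
          (min δ (1 / (1024 * K * Lt ^ 9))) ^ m := h0
    _ = m.factorial * (1536 * K * Lt ^ 9 + B) * (8 / (1 + t ^ 2)) *
          (1 / (min δ (1 / (1024 * K * Lt ^ 9))) ^ m) := by ring
    _ ≤ m.factorial * ((1536 * K + B) * Lt ^ 9) * (16 * u ^ (-2 : ℝ)) *
          ((1 / δ ^ m + (1024 * K) ^ m) * Lt ^ (9 * m)) := by gcongr
    _ = m.factorial * (1536 * K + B) * 16 * (1 / δ ^ m + (1024 * K) ^ m) *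
          Lt ^ N * u ^ (-2 : ℝ) := by
        rw [hNdef, pow_add, pow_mul]; ring
    _ ≤ m.factorial * (1536 * K + B) * 16 * (1 / δ ^ m + (1024 * K) ^ m) *
          ((2 * N) ^ N * 3 * u ^ (1 / 2 : ℝ)) * u ^ (-2 : ℝ) := by gcongr
    _ = C * (u ^ (1 / 2 : ℝ) * u ^ (-2 : ℝ)) := by rw [hCdef]; ring
    _ = C * u ^ (-(3 / 2 : ℝ)) := by rw [← Real.rpow_add hu0]; norm_num
/-! ## Integration by parts along the lines `Re s = σ ∈ [1, 3/2]` -/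

/-- `Φ(s) = (ζ₁'/ζ₁)(s)/(s(s+1))` is analytic off the zeros of `ζ₁` and off `s = 0, -1`.
[folklore] -/
theorem analyticAt_Phi {z : ℂ} (h1 : riemannZeta₁ z ≠ 0) (h2 : z ≠ 0) (h3 : z + 1 ≠ 0) :
    AnalyticAt ℂ (fun z : ℂ ↦ deriv riemannZeta₁ z / riemannZeta₁ z * (1 / (z * (z + 1)))) z := by
  set U : Set ℂ := {z | riemannZeta₁ z ≠ 0} ∩ ({z | z ≠ 0} ∩ {z | z + 1 ≠ 0}) with hU
  have hUo : IsOpen U :=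
    (isOpen_ne_fun differentiable_riemannZeta₁.continuous continuous_const).inter
      ((isOpen_ne_fun continuous_id continuous_const).inter
        (isOpen_ne_fun (continuous_id.add continuous_const) continuous_const))
  have hd : DifferentiableOn ℂ
      (fun z : ℂ ↦ deriv riemannZeta₁ z / riemannZeta₁ z * (1 / (z * (z + 1)))) U := by
    rintro w ⟨hw1, hw2, hw3⟩
    refine DifferentiableAt.differentiableWithinAt ?_
    refine DifferentiableAt.mul (DifferentiableAt.div ?_ ?_ hw1) ?_
    · exact (differentiable_riemannZeta₁.analyticAt w).deriv.differentiableAt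
    · exact differentiable_riemannZeta₁ w
    · exact DifferentiableAt.div (differentiableAt_const _) (by fun_prop) (mul_ne_zero hw2 hw3)
  exact hd.analyticAt (hUo.mem_nhds ⟨h1, h2, h3⟩)

/-- Points of the lines `Re s = σ ≥ 1` are such points. [folklore] -/
theorem line_mem {σ : ℝ} (hσ : 1 ≤ σ) (t : ℝ) :
    riemannZeta₁ ((σ : ℂ) + t * I) ≠ 0 ∧ ((σ : ℂ) + t * I) ≠ 0 ∧ ((σ : ℂ) + t * I) + 1 ≠ 0 := by
  refine ⟨Literature.NumberTheory.LFunctions.ZetaOneLine.riemannZeta₁_ne_zero_of_one_le_re (by simp; linarith), ?_, ?_⟩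
  · intro h; have := congrArg Complex.re h; simp at this; linarith
  · intro h; have := congrArg Complex.re h; simp at this; linarith

/-- Differentiation along the line: `d/dt Φ^{(j)}(σ+it) = i Φ^{(j+1)}(σ+it)` (`σ ≥ 1`).
[folklore] -/
theorem hasDerivAt_iteratedDeriv_Phi_line {σ : ℝ} (hσ : 1 ≤ σ) (j : ℕ) (t : ℝ) :
    HasDerivAt (fun y : ℝ ↦ iteratedDeriv j
        (fun z : ℂ ↦ deriv riemannZeta₁ z / riemannZeta₁ z * (1 / (z * (z + 1)))) ((σ : ℂ) + y * I))
      (iteratedDeriv (j + 1)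
        (fun z : ℂ ↦ deriv riemannZeta₁ z / riemannZeta₁ z * (1 / (z * (z + 1)))) ((σ : ℂ) + t * I) *
          I) t := by
  obtain ⟨h1, h2, h3⟩ := line_mem hσ t
  set F := fun z : ℂ ↦ deriv riemannZeta₁ z / riemannZeta₁ z * (1 / (z * (z + 1))) with hF
  have hA : AnalyticAt ℂ (iteratedDeriv j F) ((σ : ℂ) + t * I) := by
    rw [iteratedDeriv_eq_iterate]
    exact (analyticAt_Phi h1 h2 h3).iterated_deriv j
  have hG : HasDerivAt (iteratedDeriv j F) (iteratedDeriv (j + 1) F ((σ : ℂ) + t * I))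
      ((σ : ℂ) + t * I) := by
    rw [iteratedDeriv_succ]
    exact hA.differentiableAt.hasDerivAt
  have hcurve : HasDerivAt (fun y : ℝ ↦ (σ : ℂ) + y * I) I t := by
    have h1 : HasDerivAt (fun y : ℝ ↦ ((y : ℝ) : ℂ)) ((1 : ℝ) : ℂ) t := (hasDerivAt_id t).ofReal_comp
    simpa using (h1.mul_const I).const_add (σ : ℂ)
  exact HasDerivAt.comp t (h := fun y : ℝ ↦ (σ : ℂ) + y * I) (h₂ := iteratedDeriv j F) hG hcurve

/-- Continuity of `t ↦ Φ^{(j)}(σ+it)` (`σ ≥ 1`). [folklore] -/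
theorem continuous_iteratedDeriv_Phi_line {σ : ℝ} (hσ : 1 ≤ σ) (j : ℕ) :
    Continuous fun y : ℝ ↦ iteratedDeriv j
      (fun z : ℂ ↦ deriv riemannZeta₁ z / riemannZeta₁ z * (1 / (z * (z + 1)))) ((σ : ℂ) + y * I) :=
  continuous_iff_continuousAt.2 fun t ↦ (hasDerivAt_iteratedDeriv_Phi_line hσ j t).continuousAt

/-- `‖x^{1+σ+it}‖ = x^{1+σ}` for `x > 0`. [folklore] -/
theorem norm_cpow_line {x : ℝ} (hx : 0 < x) (σ t : ℝ) :
    ‖(x : ℂ) ^ (1 + ((σ : ℂ) + t * I))‖ = x ^ (1 + σ) := by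
  rw [norm_cpow_eq_rpow_re_of_pos hx]; simp

/-- `d/dt x^{1+σ+it} = x^{1+σ+it} · (i log x)` for `x > 0`. [folklore] -/
theorem hasDerivAt_cpow_line {x : ℝ} (hx : 0 < x) (σ t : ℝ) :
    HasDerivAt (fun y : ℝ ↦ (x : ℂ) ^ (1 + ((σ : ℂ) + y * I)))
      ((x : ℂ) ^ (1 + ((σ : ℂ) + t * I)) * ((Real.log x : ℂ) * I)) t := by
  have hxC : (x : ℂ) ≠ 0 := ofReal_ne_zero.mpr hx.ne'
  have h1 : HasDerivAt (fun w : ℂ ↦ 1 + ((σ : ℂ) + w * I)) I (t : ℂ) := by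
    simpa using (((hasDerivAt_id (t : ℂ)).mul_const I).const_add (σ : ℂ)).const_add (1 : ℂ)
  have h2 := h1.const_cpow (c := (x : ℂ)) (Or.inl hxC)
  have h3 := h2.comp_ofReal
  rw [← Complex.ofReal_log hx.le] at h3
  simpa [mul_assoc] using h3

/-- Continuity of `t ↦ x^{1+σ+it}` (`x > 0`). [folklore] -/
theorem continuous_cpow_line {x : ℝ} (hx : 0 < x) (σ : ℝ) :
    Continuous fun y : ℝ ↦ (x : ℂ) ^ (1 + ((σ : ℂ) + y * I)) :=
  continuous_iff_continuousAt.2 fun t ↦ (hasDerivAt_cpow_line hx σ t).continuousAt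

/-- Decay of the majorant `(1+|t|)^{-3/2}` at `+∞`. [folklore] -/
theorem tendsto_one_add_abs_rpow_atTop :
    Tendsto (fun t : ℝ ↦ (1 + |t|) ^ (-(3 / 2 : ℝ))) atTop (𝓝 0) := by
  have h1 : Tendsto (fun t : ℝ ↦ 1 + |t|) atTop atTop :=
    tendsto_atTop_add_const_left _ _ tendsto_abs_atTop_atTop
  exact (tendsto_rpow_neg_atTop (by norm_num : (0 : ℝ) < 3 / 2)).comp h1

/-- Decay of the majorant `(1+|t|)^{-3/2}` at `-∞`. [folklore] -/
theorem tendsto_one_add_abs_rpow_atBot :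
    Tendsto (fun t : ℝ ↦ (1 + |t|) ^ (-(3 / 2 : ℝ))) atBot (𝓝 0) := by
  have h1 : Tendsto (fun t : ℝ ↦ 1 + |t|) atBot atTop :=
    tendsto_atTop_add_const_left _ _ tendsto_abs_atBot_atTop
  exact (tendsto_rpow_neg_atTop (by norm_num : (0 : ℝ) < 3 / 2)).comp h1

/-- Absolute convergence of `∫ x^{1+s} Φ^{(j)}(s) dt` on `Re s = σ ∈ [1, 3/2]`. [folklore] -/
theorem integrable_cpow_mul_iteratedDeriv {x : ℝ} (hx : 0 < x) {σ : ℝ} (hσ1 : 1 ≤ σ)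
    (hσ2 : σ ≤ 3 / 2) (j : ℕ) :
    Integrable fun t : ℝ ↦ (x : ℂ) ^ (1 + ((σ : ℂ) + t * I)) * iteratedDeriv j
      (fun z : ℂ ↦ deriv riemannZeta₁ z / riemannZeta₁ z * (1 / (z * (z + 1)))) ((σ : ℂ) + t * I) := by
  obtain ⟨C, hC0, hC⟩ := exists_bound_iteratedDeriv j
  -- the majorant `(1+|t|)^{-3/2}` is Mathlib's `integrable_one_add_norm`
  have hI : Integrable fun t : ℝ ↦ (1 + |t|) ^ (-(3 / 2 : ℝ)) := by
    simpa [Real.norm_eq_abs] using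
      integrable_one_add_norm (E := ℝ) (μ := volume) (r := 3 / 2) (by simp; norm_num)
  refine Integrable.mono' (hI.const_mul (x ^ (1 + σ) * C))
    ((continuous_cpow_line hx σ).mul (continuous_iteratedDeriv_Phi_line hσ1 j)).aestronglyMeasurable
    (Eventually.of_forall fun t ↦ ?_)
  rw [norm_mul, norm_cpow_line hx, mul_assoc]
  gcongr
  exact hC σ hσ1 hσ2 t

/-- **One integration by parts along `Re s = σ`.** For `x > 1`, `1 ≤ σ ≤ 3/2` and every `j`,
`∫ x^{1+s} Φ^{(j)}(s) dt = -(1/log x) ∫ x^{1+s} Φ^{(j+1)}(s) dt` (`s = σ+it`; the boundary terms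
vanish by `exists_bound_iteratedDeriv`). [folklore] -/
theorem integral_cpow_mul_iteratedDeriv_eq {x : ℝ} (hx : 1 < x) {σ : ℝ} (hσ1 : 1 ≤ σ)
    (hσ2 : σ ≤ 3 / 2) (j : ℕ) :
    ∫ t : ℝ, (x : ℂ) ^ (1 + ((σ : ℂ) + t * I)) * iteratedDeriv j
        (fun z : ℂ ↦ deriv riemannZeta₁ z / riemannZeta₁ z * (1 / (z * (z + 1)))) ((σ : ℂ) + t * I) =
      -(1 / (Real.log x : ℂ)) * ∫ t : ℝ, (x : ℂ) ^ (1 + ((σ : ℂ) + t * I)) * iteratedDeriv (j + 1)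
        (fun z : ℂ ↦ deriv riemannZeta₁ z / riemannZeta₁ z * (1 / (z * (z + 1))))
          ((σ : ℂ) + t * I) := by
  have hx0 : 0 < x := by linarith
  have hL : 0 < Real.log x := Real.log_pos hx
  set L : ℂ := (Real.log x : ℂ) with hLdef
  have hL0 : L ≠ 0 := ofReal_ne_zero.mpr hL.ne'
  set F := fun z : ℂ ↦ deriv riemannZeta₁ z / riemannZeta₁ z * (1 / (z * (z + 1))) with hF
  set u : ℝ → ℂ := fun t ↦ (x : ℂ) ^ (1 + ((σ : ℂ) + t * I)) with hu
  set u' : ℝ → ℂ := fun t ↦ (x : ℂ) ^ (1 + ((σ : ℂ) + t * I)) * (L * I) with hu'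
  set v : ℝ → ℂ := fun t ↦ iteratedDeriv j F ((σ : ℂ) + t * I) with hv
  set v' : ℝ → ℂ := fun t ↦ iteratedDeriv (j + 1) F ((σ : ℂ) + t * I) * I with hv'
  have hdu : ∀ t, HasDerivAt u (u' t) t := fun t ↦ hasDerivAt_cpow_line hx0 σ t
  have hdv : ∀ t, HasDerivAt v (v' t) t := fun t ↦ hasDerivAt_iteratedDeriv_Phi_line hσ1 j t
  have hint1 : Integrable fun t ↦ u t * v t := integrable_cpow_mul_iteratedDeriv hx0 hσ1 hσ2 j
  have hint2 : Integrable fun t ↦ u t * iteratedDeriv (j + 1) F ((σ : ℂ) + t * I) :=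
    integrable_cpow_mul_iteratedDeriv hx0 hσ1 hσ2 (j + 1)
  have huv' : Integrable (u * v') := by
    have : u * v' = fun t ↦ u t * iteratedDeriv (j + 1) F ((σ : ℂ) + t * I) * I := by
      funext t; simp only [Pi.mul_apply, hv']; ring
    rw [this]; exact hint2.mul_const I
  have hu'v : Integrable (u' * v) := by
    have : u' * v = fun t ↦ L * I * (u t * v t) := by
      funext t; simp only [Pi.mul_apply, hu', hu]; ring
    rw [this]; exact hint1.const_mul (L * I)
  -- boundary terms
  obtain ⟨C, hC0, hC⟩ := exists_bound_iteratedDeriv j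
  have hbd : ∀ t, ‖(u * v) t‖ ≤ x ^ (1 + σ) * C * (1 + |t|) ^ (-(3 / 2 : ℝ)) := by
    intro t
    rw [Pi.mul_apply, norm_mul, hu, norm_cpow_line hx0, mul_assoc]
    gcongr
    exact hC σ hσ1 hσ2 t
  have h_top : Tendsto (u * v) atTop (𝓝 0) :=
    squeeze_zero_norm hbd
      (by simpa using (tendsto_one_add_abs_rpow_atTop).const_mul (x ^ (1 + σ) * C))
  have h_bot : Tendsto (u * v) atBot (𝓝 0) :=
    squeeze_zero_norm hbd
      (by simpa using (tendsto_one_add_abs_rpow_atBot).const_mul (x ^ (1 + σ) * C))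
  have hibp := integral_mul_deriv_eq_deriv_mul (fun t _ ↦ hdu t) (fun t _ ↦ hdv t) huv' hu'v
    h_bot h_top
  have e1 : ∫ t, u t * v' t = (∫ t, u t * iteratedDeriv (j + 1) F ((σ : ℂ) + t * I)) * I := by
    rw [← integral_mul_const]
    refine integral_congr_ae (Eventually.of_forall fun t ↦ ?_)
    simp only [hv']; ring
  have e2 : ∫ t, u' t * v t = L * I * ∫ t, u t * v t := by
    rw [← integral_const_mul]
    refine integral_congr_ae (Eventually.of_forall fun t ↦ ?_)
    simp only [hu', hu]; ring
  rw [e1, e2, sub_zero, zero_sub] at hibp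
  have hA : (∫ t, u t * iteratedDeriv (j + 1) F ((σ : ℂ) + t * I)) = -L * ∫ t, u t * v t := by
    apply mul_right_cancel₀ I_ne_zero
    rw [hibp]; ring
  change (∫ t, u t * v t) = -(1 / L) * ∫ t, u t * iteratedDeriv (j + 1) F ((σ : ℂ) + t * I)
  rw [hA]
  simp only [neg_mul, mul_neg, neg_neg]
  rw [← mul_assoc, one_div_mul_cancel hL0, one_mul]

/-- `m`-fold integration by parts: `∫ x^{1+s} Φ(s) dt = (-1/log x)^m ∫ x^{1+s} Φ^{(m)}(s) dt`.
[folklore] -/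
theorem integral_cpow_mul_Phi_eq_pow {x : ℝ} (hx : 1 < x) {σ : ℝ} (hσ1 : 1 ≤ σ)
    (hσ2 : σ ≤ 3 / 2) (m : ℕ) :
    ∫ t : ℝ, (x : ℂ) ^ (1 + ((σ : ℂ) + t * I)) * iteratedDeriv 0
        (fun z : ℂ ↦ deriv riemannZeta₁ z / riemannZeta₁ z * (1 / (z * (z + 1)))) ((σ : ℂ) + t * I) =
      (-(1 / (Real.log x : ℂ))) ^ m * ∫ t : ℝ, (x : ℂ) ^ (1 + ((σ : ℂ) + t * I)) * iteratedDeriv m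
        (fun z : ℂ ↦ deriv riemannZeta₁ z / riemannZeta₁ z * (1 / (z * (z + 1))))
          ((σ : ℂ) + t * I) := by
  induction m with
  | zero => simp
  | succ m ih => rw [ih, integral_cpow_mul_iteratedDeriv_eq hx hσ1 hσ2 m, pow_succ, mul_assoc]

/-- **The remainder integral is `O_m(x^{1+σ}/(log x)^m)`**, uniformly in `1 ≤ σ ≤ 3/2`:
`‖∫ x^{1+s} (ζ₁'/ζ₁)(s) ds/(s(s+1))‖ ≤ C_m x^{1+σ}/(log x)^m` for `x > 1`. [folklore] -/
theorem norm_integral_cpow_mul_Phi_le (m : ℕ) : ∃ C : ℝ, 0 ≤ C ∧ ∀ x : ℝ, 1 < x →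
    ∀ σ : ℝ, 1 ≤ σ → σ ≤ 3 / 2 →
      ‖∫ t : ℝ, (x : ℂ) ^ (1 + ((σ : ℂ) + t * I)) *
        (deriv riemannZeta₁ ((σ : ℂ) + t * I) / riemannZeta₁ ((σ : ℂ) + t * I)) *
          (1 / (((σ : ℂ) + t * I) * ((σ : ℂ) + t * I + 1)))‖ ≤
        C * x ^ (1 + σ) / Real.log x ^ m := by
  obtain ⟨C, hC0, hC⟩ := exists_bound_iteratedDeriv m
  set J : ℝ := ∫ t : ℝ, (1 + |t|) ^ (-(3 / 2 : ℝ)) with hJ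
  have hJ0 : 0 ≤ J := integral_nonneg fun t ↦ by positivity
  refine ⟨C * J, by positivity, fun x hx σ hσ1 hσ2 ↦ ?_⟩
  have hx0 : 0 < x := by linarith
  have hL : 0 < Real.log x := Real.log_pos hx
  set F := fun z : ℂ ↦ deriv riemannZeta₁ z / riemannZeta₁ z * (1 / (z * (z + 1))) with hF
  have hfun : (fun t : ℝ ↦ (x : ℂ) ^ (1 + ((σ : ℂ) + t * I)) *
      (deriv riemannZeta₁ ((σ : ℂ) + t * I) / riemannZeta₁ ((σ : ℂ) + t * I)) *
        (1 / (((σ : ℂ) + t * I) * ((σ : ℂ) + t * I + 1)))) =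
      fun t : ℝ ↦ (x : ℂ) ^ (1 + ((σ : ℂ) + t * I)) * iteratedDeriv 0 F ((σ : ℂ) + t * I) := by
    funext t
    simp only [iteratedDeriv_zero, hF]
    ring
  have hbound : ‖∫ t : ℝ, (x : ℂ) ^ (1 + ((σ : ℂ) + t * I)) * iteratedDeriv m F ((σ : ℂ) + t * I)‖ ≤
      x ^ (1 + σ) * C * J := by
    have hI : Integrable fun t : ℝ ↦ (1 + |t|) ^ (-(3 / 2 : ℝ)) := by
      simpa [Real.norm_eq_abs] using
        integrable_one_add_norm (E := ℝ) (μ := volume) (r := 3 / 2) (by simp; norm_num)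
    rw [hJ, ← integral_const_mul]
    refine norm_integral_le_of_norm_le (hI.const_mul _)
      (Eventually.of_forall fun t ↦ ?_)
    rw [norm_mul, norm_cpow_line hx0, mul_assoc]
    gcongr
    exact hC σ hσ1 hσ2 t
  rw [hfun, integral_cpow_mul_Phi_eq_pow hx hσ1 hσ2 m, norm_mul, norm_pow, norm_neg, norm_div,
    norm_one, Complex.norm_real, Real.norm_of_nonneg hL.le]
  calc (1 / Real.log x) ^ m *
        ‖∫ t : ℝ, (x : ℂ) ^ (1 + ((σ : ℂ) + t * I)) * iteratedDeriv m F ((σ : ℂ) + t * I)‖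
      ≤ (1 / Real.log x) ^ m * (x ^ (1 + σ) * C * J) := by gcongr
    _ = C * J * x ^ (1 + σ) / Real.log x ^ m := by rw [one_div_pow]; ring

/-- **The smoothed prime number theorem with error `O_m(x²/(log x)^m)`.** For every `m` there is
`C` such that `|ψ₁(x) - (x-1)²/2| ≤ C x²/(log x)^m` for all `x ≥ e²`, where
`ψ₁(x) = ∑_{n ≤ x} Λ(n)(x-n) = ∫₁^x ψ(u) du`: the remainder formula `rieszMean_sub_mainTerm_eq` on
the line `σ = 1 + 1/log x` (where `x^{1+σ} = e x²`) and `norm_integral_cpow_mul_Phi_le`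
(Titchmarsh §3.7 takes `σ = 1` and the Riemann–Lebesgue lemma to get `h(x) ∼ x`; here `m`
integrations by parts along the line, fed by (3.6.5)–(3.6.6) through `exists_bound_iteratedDeriv`,
give every fixed power of `log x`, with no contour shift). [folklore] -/
theorem abs_rieszMean_sub_mainTerm_le (m : ℕ) : ∃ C : ℝ, 0 ≤ C ∧ ∀ x : ℝ, Real.exp 2 ≤ x →
    |(∑ n ∈ Finset.Ioc 0 ⌊x⌋₊, (Λ n : ℝ) * (x - n)) - (x - 1) ^ 2 / 2| ≤
      C * x ^ 2 / Real.log x ^ m := by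
  obtain ⟨C, hC0, hC⟩ := norm_integral_cpow_mul_Phi_le m
  refine ⟨Real.exp 1 * C / (2 * π), by positivity, fun x hx ↦ ?_⟩
  have he : (1 : ℝ) < Real.exp 2 := by have := Real.add_one_le_exp (2 : ℝ); linarith
  have hx1 : 1 < x := he.trans_le hx
  have hx0 : 0 < x := by linarith
  have hL : 2 ≤ Real.log x := by
    rw [Real.le_log_iff_exp_le hx0]; exact hx
  have hL0 : 0 < Real.log x := by linarith
  set σ : ℝ := 1 + 1 / Real.log x with hσ
  have hσ1 : 1 < σ := by
    rw [hσ]; have : 0 < 1 / Real.log x := (by positivity); linarith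
  have hσ2 : σ ≤ 3 / 2 := by
    rw [hσ]
    have : 1 / Real.log x ≤ 1 / 2 := one_div_le_one_div_of_le (by norm_num) hL
    linarith
  obtain ⟨-, hform⟩ := rieszMean_sub_mainTerm_eq hx1.le hσ1
  have hxpow : x ^ (1 + σ) = Real.exp 1 * x ^ 2 := by
    have : 1 + σ = 2 + 1 / Real.log x := by rw [hσ]; ring
    rw [this, Real.rpow_add hx0, Real.rpow_two, Real.rpow_def_of_pos hx0,
      mul_one_div_cancel hL0.ne']
    ring
  have h1 := hC x hx1 σ hσ1.le hσ2
  rw [hxpow] at h1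
  rw [← Real.norm_eq_abs, ← Complex.norm_real, hform, norm_mul, norm_neg, norm_div, norm_one,
    norm_mul, Complex.norm_ofNat, Complex.norm_real, Real.norm_of_nonneg Real.pi_pos.le]
  calc 1 / (2 * π) * ‖∫ t : ℝ, (x : ℂ) ^ (1 + ((σ : ℂ) + t * I)) *
          (deriv riemannZeta₁ ((σ : ℂ) + t * I) / riemannZeta₁ ((σ : ℂ) + t * I)) *
            (1 / (((σ : ℂ) + t * I) * ((σ : ℂ) + t * I + 1)))‖
      ≤ 1 / (2 * π) * (C * (Real.exp 1 * x ^ 2) / Real.log x ^ m) := by gcongr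
    _ = Real.exp 1 * C / (2 * π) * x ^ 2 / Real.log x ^ m := by ring
/-! ## Unsmoothing: from `ψ₁` to `ψ` -/

/-- `ψ₁(y) - ψ₁(x) ≥ (y - x) ψ(x)` for `0 ≤ x ≤ y` (`ψ₁(x) = ∑_{n ≤ x} Λ(n)(x - n)`,
`ψ` = Mathlib's `Chebyshev.psi`). [folklore] -/
theorem mul_psi_le_rieszMean_sub {x y : ℝ} (hx : 0 ≤ x) (hxy : x ≤ y) :
    (y - x) * Chebyshev.psi x ≤ (∑ n ∈ Finset.Ioc 0 ⌊y⌋₊, (Λ n : ℝ) * (y - n)) -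
      ∑ n ∈ Finset.Ioc 0 ⌊x⌋₊, (Λ n : ℝ) * (x - n) := by
  have hy : 0 ≤ y := hx.trans hxy
  have hNM : ⌊x⌋₊ ≤ ⌊y⌋₊ := Nat.floor_le_floor hxy
  rw [← Finset.sum_Ioc_consecutive _ (Nat.zero_le ⌊x⌋₊) hNM, Chebyshev.psi, Finset.mul_sum]
  have h1 : ∑ n ∈ Finset.Ioc 0 ⌊x⌋₊, (Λ n : ℝ) * (y - n) -
      ∑ n ∈ Finset.Ioc 0 ⌊x⌋₊, (Λ n : ℝ) * (x - n) = ∑ n ∈ Finset.Ioc 0 ⌊x⌋₊, (y - x) * Λ n := by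
    rw [← Finset.sum_sub_distrib]
    exact Finset.sum_congr rfl fun n _ ↦ by ring
  have h2 : 0 ≤ ∑ n ∈ Finset.Ioc ⌊x⌋₊ ⌊y⌋₊, (Λ n : ℝ) * (y - n) := by
    refine Finset.sum_nonneg fun n hn ↦ mul_nonneg ArithmeticFunction.vonMangoldt_nonneg ?_
    have hn2 := (Finset.mem_Ioc.mp hn).2
    have : (n : ℝ) ≤ ⌊y⌋₊ := by exact_mod_cast hn2
    linarith [Nat.floor_le hy]
  linarith

/-- `ψ₁(y) - ψ₁(x) ≤ (y - x) ψ(y)` for `0 ≤ x ≤ y`. [folklore] -/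
theorem rieszMean_sub_le_mul_psi {x y : ℝ} (hx : 0 ≤ x) (hxy : x ≤ y) :
    (∑ n ∈ Finset.Ioc 0 ⌊y⌋₊, (Λ n : ℝ) * (y - n)) -
      ∑ n ∈ Finset.Ioc 0 ⌊x⌋₊, (Λ n : ℝ) * (x - n) ≤ (y - x) * Chebyshev.psi y := by
  have hy : 0 ≤ y := hx.trans hxy
  have hNM : ⌊x⌋₊ ≤ ⌊y⌋₊ := Nat.floor_le_floor hxy
  rw [Chebyshev.psi, ← Finset.sum_Ioc_consecutive _ (Nat.zero_le ⌊x⌋₊) hNM,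
    ← Finset.sum_Ioc_consecutive _ (Nat.zero_le ⌊x⌋₊) hNM, mul_add, Finset.mul_sum,
    Finset.mul_sum]
  have h1 : ∑ n ∈ Finset.Ioc 0 ⌊x⌋₊, (Λ n : ℝ) * (y - n) -
      ∑ n ∈ Finset.Ioc 0 ⌊x⌋₊, (Λ n : ℝ) * (x - n) = ∑ n ∈ Finset.Ioc 0 ⌊x⌋₊, (y - x) * Λ n := by
    rw [← Finset.sum_sub_distrib]
    exact Finset.sum_congr rfl fun n _ ↦ by ring
  have h2 : ∑ n ∈ Finset.Ioc ⌊x⌋₊ ⌊y⌋₊, (Λ n : ℝ) * (y - n) ≤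
      ∑ n ∈ Finset.Ioc ⌊x⌋₊ ⌊y⌋₊, (y - x) * Λ n := by
    refine Finset.sum_le_sum fun n hn ↦ ?_
    have hn1 := (Finset.mem_Ioc.mp hn).1
    have hxn : x < n := Nat.lt_of_floor_lt hn1
    rw [mul_comm (y - x)]
    exact mul_le_mul_of_nonneg_left (by linarith) ArithmeticFunction.vonMangoldt_nonneg
  linarith

/-- **The prime number theorem with error `O_A(x/(log x)^A)`, `ψ`-form**: for every real `A`,
`ψ(x) - x = O(x/(log x)^A)`. A weak form of de la Vallée Poussin's theorem (Montgomery–Vaughan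
Thm. 6.9 (6.12): `O(x exp(-c√log x))`; Titchmarsh §3.7 proves `π(x) ∼ x/log x` by the route
followed here), and exactly the input of the tree's
`Literature.NumberTheory.Sieve.primesHaveLevel_iff_primesHaveLevelPi_of_isBigO`. Proof: `abs_rieszMean_sub_mainTerm_le` with
`m = 2a`, `a = max 1 ⌈A⌉₊`, unsmoothed over windows of length `h = x/(log x)^a`
(`mul_psi_le_rieszMean_sub`, `rieszMean_sub_le_mul_psi`; Titchmarsh's lemma in §3.7 is the
qualitative version of this step).  The cite is to the printed (stronger) statement, of which this
is the immediate log-power weakening. [cite: MontgomeryVaughan2007, Theorem 6.9 (6.12)] -/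
theorem chebyshevPsi_sub_self_isBigO_div_logPow (A : ℝ) :
    (fun x : ℝ ↦ Chebyshev.psi x - x) =O[atTop] fun x : ℝ ↦ x / Real.log x ^ A := by
  set a : ℕ := max 1 ⌈A⌉₊ with ha
  have ha1 : 1 ≤ a := le_max_left _ _
  have haA : A ≤ a := (Nat.le_ceil A).trans (by exact_mod_cast le_max_right 1 ⌈A⌉₊)
  obtain ⟨C, hC0, hC⟩ := abs_rieszMean_sub_mainTerm_le (a + a)
  -- Step 1: an explicit bound for `x ≥ 2e²`.
  have he1 : (1 : ℝ) < Real.exp 2 := by have := Real.add_one_le_exp (2 : ℝ); linarith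
  have step : ∀ x : ℝ, 2 * Real.exp 2 ≤ x →
      |Chebyshev.psi x - x| ≤ 1 + (1 / 2 + (5 + 2 ^ (a + a)) * C) * (x / Real.log x ^ a) := by
    intro x hx
    have hx2 : Real.exp 2 ≤ x := by linarith [Real.exp_pos 2]
    have hx0 : 0 < x := by linarith
    have hL : 2 ≤ Real.log x := by rw [Real.le_log_iff_exp_le hx0]; exact hx2
    set L := Real.log x with hLdef
    have hL1 : 1 ≤ L := by linarith
    have hLa : 2 ≤ L ^ a := by
      calc (2 : ℝ) = 2 ^ 1 := by norm_num
        _ ≤ L ^ 1 := by gcongr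
        _ ≤ L ^ a := pow_le_pow_right₀ hL1 ha1
    have hLa0 : 0 < L ^ a := by positivity
    set P := x / L ^ a with hP
    have hP0 : 0 < P := by positivity
    have hPx : P * L ^ a = x := by rw [hP]; field_simp
    have hP2 : P ≤ x / 2 := div_le_div_of_nonneg_left hx0.le (by norm_num) hLa
    have hm : L ^ (a + a) = L ^ a * L ^ a := pow_add _ _ _
    have hxsq : x ^ 2 = P ^ 2 * L ^ (a + a) := by rw [hm, ← hPx]; ring
    -- the three remainder bounds, all `≤ const · P²`
    set E : ℝ → ℝ := fun y ↦ (∑ n ∈ Finset.Ioc 0 ⌊y⌋₊, (Λ n : ℝ) * (y - n)) - (y - 1) ^ 2 / 2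
      with hE
    have hEx : |E x| ≤ C * P ^ 2 := by
      have := hC x hx2
      rw [hxsq] at this
      calc |E x| ≤ C * (P ^ 2 * L ^ (a + a)) / L ^ (a + a) := this
        _ = C * P ^ 2 := by field_simp
    have hEp : |E (x + P)| ≤ 4 * C * P ^ 2 := by
      have h1 := hC (x + P) (by linarith)
      have hlog : L ≤ Real.log (x + P) := Real.log_le_log hx0 (by linarith)
      have hlog0 : 0 < Real.log (x + P) ^ (a + a) := pow_pos (by linarith) _
      calc |E (x + P)| ≤ C * (x + P) ^ 2 / Real.log (x + P) ^ (a + a) := h1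
        _ ≤ C * (2 * x) ^ 2 / L ^ (a + a) := by
            gcongr
            · linarith
        _ = 4 * C * P ^ 2 := by rw [mul_pow, hxsq]; field_simp; ring
    have hEm : |E (x - P)| ≤ 2 ^ (a + a) * C * P ^ 2 := by
      have hxP : Real.exp 2 ≤ x - P := by linarith
      have h1 := hC (x - P) hxP
      have hlog2 : L / 2 ≤ Real.log (x - P) := by
        have hx2' : x / 2 ≤ x - P := by linarith
        have hl2 : Real.log 2 < 1 := by
          have := Real.log_two_lt_d9; linarith
        calc L / 2 ≤ L - Real.log 2 := by linarith
          _ = Real.log (x / 2) := by rw [Real.log_div hx0.ne' (by norm_num)]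
          _ ≤ Real.log (x - P) := Real.log_le_log (by positivity) hx2'
      have hlog0 : 0 < (L / 2) ^ (a + a) := by positivity
      calc |E (x - P)| ≤ C * (x - P) ^ 2 / Real.log (x - P) ^ (a + a) := h1
        _ ≤ C * x ^ 2 / (L / 2) ^ (a + a) := by
            gcongr
            · linarith
            · linarith
        _ = 2 ^ (a + a) * C * P ^ 2 := by rw [div_pow, hxsq]; field_simp
    -- unsmoothing
    have hup := mul_psi_le_rieszMean_sub hx0.le (show x ≤ x + P by linarith)
    have hdown := rieszMean_sub_le_mul_psi (show 0 ≤ x - P by linarith [Real.exp_pos 2])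
      (show x - P ≤ x by linarith)
    have eup : (∑ n ∈ Finset.Ioc 0 ⌊x + P⌋₊, (Λ n : ℝ) * (x + P - n)) -
        ∑ n ∈ Finset.Ioc 0 ⌊x⌋₊, (Λ n : ℝ) * (x - n) =
          E (x + P) - E x + (P * (x - 1) + P ^ 2 / 2) := by simp only [hE]; ring
    have edown : (∑ n ∈ Finset.Ioc 0 ⌊x⌋₊, (Λ n : ℝ) * (x - n)) -
        ∑ n ∈ Finset.Ioc 0 ⌊x - P⌋₊, (Λ n : ℝ) * (x - P - n) =
          E x - E (x - P) + (P * (x - 1) - P ^ 2 / 2) := by simp only [hE]; ring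
    rw [eup, show x + P - x = P by ring] at hup
    rw [edown, show x - (x - P) = P by ring] at hdown
    have hEx1 := (abs_le.mp hEx)
    have hEp1 := (abs_le.mp hEp)
    have hEm1 := (abs_le.mp hEm)
    -- upper bound: `P ψ(x) ≤ P(x-1) + P²/2 + 5 C P²`
    have hU : Chebyshev.psi x - x ≤ (1 / 2 + (5 + 2 ^ (a + a)) * C) * P := by
      have h1 : P * Chebyshev.psi x ≤ P * (x - 1 + (1 / 2 + 5 * C) * P) := by
        calc P * Chebyshev.psi x ≤ E (x + P) - E x + (P * (x - 1) + P ^ 2 / 2) := hup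
          _ ≤ 4 * C * P ^ 2 + C * P ^ 2 + (P * (x - 1) + P ^ 2 / 2) := by
              linarith only [hEp1.2, hEx1.1]
          _ = P * (x - 1 + (1 / 2 + 5 * C) * P) := by ring
      have h2 := le_of_mul_le_mul_left h1 hP0
      have h3 : 0 ≤ 2 ^ (a + a) * C * P := by positivity
      have h4 : (1 / 2 + (5 + 2 ^ (a + a)) * C) * P =
          (1 / 2 + 5 * C) * P + 2 ^ (a + a) * C * P := by ring
      linarith only [h2, h3, h4]
    -- lower bound: `P ψ(x) ≥ P(x-1) - P²/2 - (1 + 2^m) C P²`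
    have hD : -(1 + (1 / 2 + (5 + 2 ^ (a + a)) * C) * P) ≤ Chebyshev.psi x - x := by
      have h1 : P * (x - 1 - (1 / 2 + (1 + 2 ^ (a + a)) * C) * P) ≤ P * Chebyshev.psi x := by
        calc P * (x - 1 - (1 / 2 + (1 + 2 ^ (a + a)) * C) * P)
            = -(C * P ^ 2) - 2 ^ (a + a) * C * P ^ 2 + (P * (x - 1) - P ^ 2 / 2) := by ring
          _ ≤ E x - E (x - P) + (P * (x - 1) - P ^ 2 / 2) := by
              linarith only [hEx1.1, hEm1.2]
          _ ≤ P * Chebyshev.psi x := hdown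
      have h2 := le_of_mul_le_mul_left h1 hP0
      have h3 : 0 ≤ 4 * C * P := by positivity
      have h4 : (1 / 2 + (5 + 2 ^ (a + a)) * C) * P =
          (1 / 2 + (1 + 2 ^ (a + a)) * C) * P + 4 * C * P := by ring
      linarith only [h2, h3, h4]
    exact abs_le.mpr ⟨by linarith only [hD], by linarith only [hU]⟩
  -- Step 2: `O`-form.
  have hev1 : ∀ᶠ x : ℝ in atTop, Real.log x ^ (a : ℝ) ≤ x := by
    have h := (isLittleO_log_rpow_rpow_atTop (a : ℝ) (by norm_num : (0 : ℝ) < 1)).bound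
      (by norm_num : (0 : ℝ) < 1)
    filter_upwards [h, eventually_ge_atTop (1 : ℝ)] with x hx hx1
    rw [Real.rpow_one, one_mul,
      Real.norm_of_nonneg (Real.rpow_nonneg (Real.log_nonneg hx1) _),
      Real.norm_of_nonneg (by linarith)] at hx
    exact hx
  refine Asymptotics.IsBigO.of_bound (1 + (1 / 2 + (5 + 2 ^ (a + a)) * C)) ?_
  filter_upwards [hev1, eventually_ge_atTop (2 * Real.exp 2)] with x hlx hx
  have hx0 : 0 < x := by linarith [Real.exp_pos 2]
  have hL : 2 ≤ Real.log x := by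
    rw [Real.le_log_iff_exp_le hx0]; linarith [Real.exp_pos 2]
  have hL1 : 1 ≤ Real.log x := by linarith
  have hlx' : Real.log x ^ a ≤ x := by rwa [Real.rpow_natCast] at hlx
  have hLa0 : 0 < Real.log x ^ a := by positivity
  have hLA0 : 0 < Real.log x ^ A := Real.rpow_pos_of_pos (by linarith) A
  have h1 : 1 ≤ x / Real.log x ^ a := by rw [le_div_iff₀ hLa0, one_mul]; exact hlx'
  have h2 : x / Real.log x ^ a ≤ x / Real.log x ^ A := by
    refine div_le_div_of_nonneg_left hx0.le hLA0 ?_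
    rw [← Real.rpow_natCast]
    exact Real.rpow_le_rpow_of_exponent_le hL1 haA
  rw [Real.norm_eq_abs, Real.norm_of_nonneg (by positivity)]
  calc |Chebyshev.psi x - x| ≤ 1 + (1 / 2 + (5 + 2 ^ (a + a)) * C) * (x / Real.log x ^ a) :=
        step x hx
    _ ≤ x / Real.log x ^ a + (1 / 2 + (5 + 2 ^ (a + a)) * C) * (x / Real.log x ^ a) := by
        gcongr
    _ = (1 + (1 / 2 + (5 + 2 ^ (a + a)) * C)) * (x / Real.log x ^ a) := by ring
    _ ≤ (1 + (1 / 2 + (5 + 2 ^ (a + a)) * C)) * (x / Real.log x ^ A) := by gcongr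

end Literature.NumberTheory.LFunctions.PsiLogPower
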